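import Summits.QuantumFields.YangMills.Theorems.DiagonalMirrorRPRDiagonalSliceModelDefs
import Summits.QuantumFields.YangMills.Theorems.MirrorModularBoostsHypercubicLimitSubschemeDefs

/-!
# Crux `WeakCouplingHypercubicLimitRP` (stmt-QuantumFields-27398), line `Sketch`, stub D1 `stub_diagRPOfPlaneLimits`, door B, λ1:
# the restriction `DiagonalSliceModel.restrict φ` of a two-sector spectral model to a sub-scheme, and the door-B letters
# and scheme clauses ALONG a subsequence

Helper file (`--supports stmt-QuantumFields-27398 --as helper`) of the hand `hand-10604-wilsonDiagModel-2` (docket director-ym g23,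
O4 WORD 18 (3)(ii) = critic idea-crit-9 g12's check λ1, 2026-08-31) for the registered stub D1 `stub_diagRPOfPlaneLimits` of
`Cruxes/WeakCouplingHypercubicLimitRP/Lines/Sketch.lean` (sha16 `7bf38c709623ad77`); it closes nothing by itself.

WHY.  Door B (core workfile `Cruxes/DiagonalMirrorRPR/Lines/sign_twisted_diagonal_trace_core.lean`, sha16 `2db7ee148edeb495`) concludes
the lattice socket `OddTorusSwapPairingLiminf r sch'` by `core_of : OddTwistGap 𝔪 → DiagLukewarm 𝔪 → Growth r sch' → socket` from a model
`𝔪 : DiagonalSliceModel r sch'`, and the lead's transfer lemma (`lead-27398-D1`: `…Theorems.PencilRigidityWeakCouplingHypercubicLimitRPSwapPairingPSD`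
+ companion) consumes the socket at the SUB-SCHEME `sch' = subseq sch φ hφ` of the D1 witness `(subseq sch φ hφ, planeSum T)`.  The hand's model
(`wilsonDiagonalModel r sch hβ`, under construction by `hand-10604-wilsonDiagModel-1`, interface re-homed in `…DiagonalSliceModelDefs`, p825205)
and its letters are typed on the SCHEME `sch`; so door B's suppliers must be transported ALONG `φ`.  This file provides exactly that bookkeeping:

* §1 the interface observables are read at `φ k` (definitionally): `famObs r (subseq sch φ hφ) F k = famObs r sch F (φ k)`,
  `gramPairing r (subseq sch φ hφ) F k = gramPairing r sch F (φ k)` (`latticeSchwinger_subseq` is `rfl`);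
* §2 **`DiagonalSliceModel.restrict`**: the `k ↦ φ k` restriction of a model on `sch` is a model on `subseq sch φ hφ` — every datum composed with
  `φ`, every pointwise field inherited, the three eventual fields (`depth_le`, `pairing_eq`, `weight_dom`) by `φ → ∞` (one line each: the model IS
  functorial in `k`); `@[simp]` projections;
* §3 the door-B LETTERS along `φ`: the bodies of `OddTwistGap` / `DiagLukewarm` (core §3, VERBATIM — their `def`s live in the `Cruxes/` workfile,
  which a `Theorems/` file cannot import, so they are unfolded here and the core obtains `OddTwistGap (𝔪.restrict φ hφ)` etc. by `exact`) transfer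
  from `𝔪` to `𝔪.restrict φ hφ`, hence `TwistLetters r sch → TwistLetters r (subseq sch φ hφ)` (unfolded: `twistLetters_subseq`);
* §4 the SCHEME clauses along `φ` (unfolded bodies of core §3 `TemperateRenormalisation`, `SideGrowth`, `Growth`, `PolyCounterterm`): they are
  relations between `c_k`, `m_k`, `L_k` and `a_k` at the SAME index or `Tendsto`/eventual statements, hence reparametrisation-stable
  (`temperateRenormalisation_subseq`, `sideGrowth_subseq`, `growth_subseq`, `polyCounterterm_subseq`); the fired stub's own clauses already have
  `polyVolume_subseq` / `polyRenorm_subseq` (`…Theorems.MirrorModularBoostsHypercubicLimitSubschemeDefs`).  ANSWER TO λ1: NO door-B clause is a bound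
  polynomial in the index `k`; nothing needs restating.

HONEST FRAMING: bookkeeping only.  No letter is proved for Wilson's model here; `wilsonDiagonalModel` is not landed; D1, the crux ⟨27398⟩ and its
heart S6i are OPEN; nothing here bears on the summit; the Yang–Mills mass gap is NOT proved here or anywhere in the tree.  No new `Prop`
definition, no instance, no notation, `autoImplicit false`.

References: Osterwalder–Seiler, Ann. Phys. 110 (1978) §2–3 (transfer matrix of lattice gauge theory); Seiler, LNP 159 (1982) Ch. 2.
-/

set_option autoImplicit false

noncomputable section

open scoped SchwartzMap
open MeasureTheory Filter Topology
open Literature.MathematicalPhysics.QuantumLattice Literature.MathematicalPhysics.AQFT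
  Literature.MathematicalPhysics.QuantumFieldTheory Literature.Probability.LatticeModels
open Summit.QuantumFields.YangMills.Cruxes.HypercubicLimit.CouplingResponse (subseq)

namespace Summit.QuantumFields.YangMills.Cruxes.DiagonalMirrorRPR.SignTwistedDiagonalTrace

/-! ## §1 The interface observables of the sub-scheme are those of the scheme read at `φ k` -/

section Observables

variable {G : Type} [Group G] [TopologicalSpace G] [IsTopologicalGroup G] [CompactSpace G]
  [MeasurableSpace G] [BorelSpace G] (r : LatticeRep G) (sch : SpeciesScheme (YMSpecies G))
  (φ : ℕ → ℕ) (hφ : StrictMono φ)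

/-- The family observable `Y_k(F)` of the sub-scheme is the scheme's at step `φ k` (definitionally: box, spacing, renormalisation and
counterterm are all read at `φ k`). -/
theorem famObs_subseq (F : ReflectedFamily) (k : ℕ) (V : LGConfig 4 G) :
    famObs r (subseq sch φ hφ) F k V = famObs r sch F (φ k) V := rfl

/-- The Gram pairing `⟨ΘY_k(F)·Y_k(F)⟩_k` of the sub-scheme is the scheme's at step `φ k` (definitionally, by `latticeSchwinger_subseq`). -/
theorem gramPairing_subseq (F : ReflectedFamily) (k : ℕ) :
    gramPairing r (subseq sch φ hφ) F k = gramPairing r sch F (φ k) := rfl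

end Observables

/-! ## §2 The restriction of a model to a sub-scheme -/

namespace DiagonalSliceModel

variable {G : Type} [Group G] [TopologicalSpace G] [IsTopologicalGroup G] [CompactSpace G]
  [MeasurableSpace G] [BorelSpace G] {r : LatticeRep G} {sch : SpeciesScheme (YMSpecies G)}

/-- **`DiagonalSliceModel.restrict`** — the `k ↦ φ k` restriction of a two-sector spectral model on the scheme `sch` to the sub-scheme
`subseq sch φ hφ`: moduli, top modulus, Gram weights and depths composed with `φ`; the pointwise axioms are inherited verbatim, and the
eventual ones (`depth_le`, `pairing_eq`, `weight_dom` — stated `∀ᶠ k in atTop`) follow because `φ → ∞` (`StrictMono.tendsto_atTop`); the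
side `(subseq sch φ hφ).side k = sch.side (φ k)` and the pairing `gramPairing r (subseq sch φ hφ) F k = gramPairing r sch F (φ k)` agree
definitionally. -/
def restrict (𝔪 : DiagonalSliceModel r sch) (φ : ℕ → ℕ) (hφ : StrictMono φ) : DiagonalSliceModel r (subseq sch φ hφ) where
  sp k j := 𝔪.sp (φ k) j
  sm k j := 𝔪.sm (φ k) j
  top k := 𝔪.top (φ k)
  top_pos k := 𝔪.top_pos (φ k)
  sp_nonneg k j := 𝔪.sp_nonneg (φ k) j
  sm_nonneg k j := 𝔪.sm_nonneg (φ k) j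
  sp_le k j := 𝔪.sp_le (φ k) j
  sm_le k j := 𝔪.sm_le (φ k) j
  top_attained k := 𝔪.top_attained (φ k)
  summable_sp k := 𝔪.summable_sp (φ k)
  summable_sm k := 𝔪.summable_sm (φ k)
  trace_nonneg k m hm hodd := 𝔪.trace_nonneg (φ k) m hm hodd
  trace_side_pos k := 𝔪.trace_side_pos (φ k)
  wp F k j := 𝔪.wp F (φ k) j
  wm F k j := 𝔪.wm F (φ k) j
  wp_nonneg F k j := 𝔪.wp_nonneg F (φ k) j
  wm_nonneg F k j := 𝔪.wm_nonneg F (φ k) j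
  w_bdd F k := 𝔪.w_bdd F (φ k)
  depth F k := 𝔪.depth F (φ k)
  depth_le F := by
    obtain ⟨R, hR⟩ := 𝔪.depth_le F
    exact ⟨R, hφ.tendsto_atTop.eventually hR⟩
  pairing_eq F := hφ.tendsto_atTop.eventually (𝔪.pairing_eq F)
  weight_dom F := hφ.tendsto_atTop.eventually (𝔪.weight_dom F)

variable (𝔪 : DiagonalSliceModel r sch) (φ : ℕ → ℕ) (hφ : StrictMono φ)

/-- Even-sector moduli of the restriction. -/
@[simp] theorem restrict_sp (k j : ℕ) : (𝔪.restrict φ hφ).sp k j = 𝔪.sp (φ k) j := rfl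

/-- Odd-sector (wrong-sign) moduli of the restriction. -/
@[simp] theorem restrict_sm (k j : ℕ) : (𝔪.restrict φ hφ).sm k j = 𝔪.sm (φ k) j := rfl

/-- Top modulus of the restriction. -/
@[simp] theorem restrict_top (k : ℕ) : (𝔪.restrict φ hφ).top k = 𝔪.top (φ k) := rfl

/-- Even-sector Gram weights of the restriction. -/
@[simp] theorem restrict_wp (F : ReflectedFamily) (k j : ℕ) : (𝔪.restrict φ hφ).wp F k j = 𝔪.wp F (φ k) j := rfl

/-- Odd-sector Gram weights of the restriction. -/
@[simp] theorem restrict_wm (F : ReflectedFamily) (k j : ℕ) : (𝔪.restrict φ hφ).wm F k j = 𝔪.wm F (φ k) j := rfl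

/-- Depths of the restriction. -/
@[simp] theorem restrict_depth (F : ReflectedFamily) (k : ℕ) : (𝔪.restrict φ hφ).depth F k = 𝔪.depth F (φ k) := rfl

/-! ## §3 The door-B letters along `φ` (bodies of core §3 `OddTwistGap` / `DiagLukewarm` / `TwistLetters`, verbatim) -/

/-- **R1 along `φ`.**  The body of `OddTwistGap 𝔪` at rate `γ` (core §3: the `U`-odd sector lies below `exp(−γ a_k)·λ₀(k)`, eventually)
transfers to the restriction: `OddTwistGap 𝔪 → OddTwistGap (𝔪.restrict φ hφ)` with the same `γ`. -/
theorem restrict_oddTwistGap {γ : ℝ}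
    (h : ∀ᶠ k in atTop, ∀ j, 𝔪.sm k j ≤ Real.exp (-(γ * sch.a k)) * 𝔪.top k) :
    ∀ᶠ k in atTop, ∀ j, (𝔪.restrict φ hφ).sm k j ≤ Real.exp (-(γ * (subseq sch φ hφ).a k)) * (𝔪.restrict φ hφ).top k :=
  hφ.tendsto_atTop.eventually h

/-- **R2 along `φ`.**  The body of `DiagLukewarm 𝔪` at `(θ, C)` (core §3: `Tr (|A_k|/λ₀)^{2t} ≤ C` for `t ≥ θ·side_k`, eventually) transfers to
the restriction: `DiagLukewarm 𝔪 → DiagLukewarm (𝔪.restrict φ hφ)` with the same `(θ, C)`. -/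
theorem restrict_diagLukewarm {θ C : ℝ}
    (h : ∀ᶠ k in atTop, ∀ t : ℕ, θ * (sch.side k : ℝ) ≤ (t : ℝ) →
      ∑' j, (𝔪.sp k j / 𝔪.top k) ^ (2 * t) + ∑' j, (𝔪.sm k j / 𝔪.top k) ^ (2 * t) ≤ C) :
    ∀ᶠ k in atTop, ∀ t : ℕ, θ * ((subseq sch φ hφ).side k : ℝ) ≤ (t : ℝ) →
      ∑' j, ((𝔪.restrict φ hφ).sp k j / (𝔪.restrict φ hφ).top k) ^ (2 * t) +
        ∑' j, ((𝔪.restrict φ hφ).sm k j / (𝔪.restrict φ hφ).top k) ^ (2 * t) ≤ C :=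
  hφ.tendsto_atTop.eventually h

end DiagonalSliceModel

section LettersAlong

variable {G : Type} [Group G] [TopologicalSpace G] [IsTopologicalGroup G] [CompactSpace G]
  [MeasurableSpace G] [BorelSpace G] (r : LatticeRep G) (sch : SpeciesScheme (YMSpecies G))
  (φ : ℕ → ℕ) (hφ : StrictMono φ)

/-- **`TwistLetters` along `φ`** (core §3 `TwistLetters r sch := ∃ 𝔪, OddTwistGap 𝔪 ∧ DiagLukewarm 𝔪`, bodies unfolded verbatim): if SOME model on
the scheme satisfies R1 and R2, then SOME model on the sub-scheme does — namely its restriction, with the same constants. -/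
theorem twistLetters_subseq
    (h : ∃ 𝔪 : DiagonalSliceModel r sch,
      (∃ γ : ℝ, 0 < γ ∧ ∀ᶠ k in atTop, ∀ j, 𝔪.sm k j ≤ Real.exp (-(γ * sch.a k)) * 𝔪.top k) ∧
      (∃ θ : ℝ, 0 < θ ∧ θ < 1 / 2 ∧ ∃ C : ℝ, ∀ᶠ k in atTop, ∀ t : ℕ, θ * (sch.side k : ℝ) ≤ (t : ℝ) →
        ∑' j, (𝔪.sp k j / 𝔪.top k) ^ (2 * t) + ∑' j, (𝔪.sm k j / 𝔪.top k) ^ (2 * t) ≤ C)) :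
    ∃ 𝔪' : DiagonalSliceModel r (subseq sch φ hφ),
      (∃ γ : ℝ, 0 < γ ∧ ∀ᶠ k in atTop, ∀ j, 𝔪'.sm k j ≤ Real.exp (-(γ * (subseq sch φ hφ).a k)) * 𝔪'.top k) ∧
      (∃ θ : ℝ, 0 < θ ∧ θ < 1 / 2 ∧ ∃ C : ℝ, ∀ᶠ k in atTop, ∀ t : ℕ, θ * ((subseq sch φ hφ).side k : ℝ) ≤ (t : ℝ) →
        ∑' j, (𝔪'.sp k j / 𝔪'.top k) ^ (2 * t) + ∑' j, (𝔪'.sm k j / 𝔪'.top k) ^ (2 * t) ≤ C) := by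
  obtain ⟨𝔪, ⟨γ, hγ, hR1⟩, ⟨θ, hθ0, hθ, C, hR2⟩⟩ := h
  exact ⟨𝔪.restrict φ hφ, ⟨γ, hγ, 𝔪.restrict_oddTwistGap φ hφ hR1⟩, ⟨θ, hθ0, hθ, C, 𝔪.restrict_diagLukewarm φ hφ hR2⟩⟩

end LettersAlong

/-! ## §4 The scheme clauses along `φ` (bodies of core §3 `TemperateRenormalisation` / `SideGrowth` / `Growth` / `PolyCounterterm`, verbatim) -/

section SchemeAlong

variable {G : Type} [Group G] [TopologicalSpace G] [IsTopologicalGroup G] [CompactSpace G]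
  [MeasurableSpace G] [BorelSpace G] (r : LatticeRep G) (sch : SpeciesScheme (YMSpecies G))
  (φ : ℕ → ℕ) (hφ : StrictMono φ)

/-- **`TemperateRenormalisation` along `φ`** (core §3 (i): `|c_k|, |m_k| ≤ (a_k⁻¹)^p` eventually — a relation at the SAME index, hence
reparametrisation-stable with the same exponent). -/
theorem temperateRenormalisation_subseq {p : ℕ}
    (h : ∀ᶠ k in atTop, |sch.c r.curvature k| ≤ (sch.a k)⁻¹ ^ p ∧ |sch.m r.curvature k| ≤ (sch.a k)⁻¹ ^ p) :
    ∀ᶠ k in atTop, |(subseq sch φ hφ).c r.curvature k| ≤ ((subseq sch φ hφ).a k)⁻¹ ^ p ∧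
      |(subseq sch φ hφ).m r.curvature k| ≤ ((subseq sch φ hφ).a k)⁻¹ ^ p :=
  hφ.tendsto_atTop.eventually h

/-- **`PolyCounterterm` along `φ`** (core §3b: `|m_k| ≤ (a_k⁻¹)^p` eventually). -/
theorem polyCounterterm_subseq {p : ℕ} (h : ∀ᶠ k in atTop, |sch.m r.curvature k| ≤ (sch.a k)⁻¹ ^ p) :
    ∀ᶠ k in atTop, |(subseq sch φ hφ).m r.curvature k| ≤ ((subseq sch φ hφ).a k)⁻¹ ^ p :=
  hφ.tendsto_atTop.eventually h

omit [TopologicalSpace G] [IsTopologicalGroup G] [CompactSpace G] [BorelSpace G] in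
/-- **`SideGrowth` along `φ`** (core §3 (ii): `a_k L_k / log a_k⁻¹ → ∞` — a `Tendsto … atTop atTop`, composed with `φ → ∞`). -/
theorem sideGrowth_subseq (h : Tendsto (fun k => sch.a k * (sch.L k : ℝ) / Real.log (sch.a k)⁻¹) atTop atTop) :
    Tendsto (fun k => (subseq sch φ hφ).a k * ((subseq sch φ hφ).L k : ℝ) / Real.log ((subseq sch φ hφ).a k)⁻¹) atTop atTop :=
  h.comp hφ.tendsto_atTop

/-- **`Growth` along `φ`** (core §3 `Growth r sch := TemperateRenormalisation r sch ∧ SideGrowth sch`, unfolded): the door-B scheme clause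
restricts to every sub-scheme.  With `polyRenorm_subseq` / `polyVolume_subseq` (tree) and `polyCounterterm_subseq` (above) the core's adapter
`growth_of_poly` may equally be run on the sub-scheme. -/
theorem growth_subseq
    (h : (∃ p : ℕ, ∀ᶠ k in atTop, |sch.c r.curvature k| ≤ (sch.a k)⁻¹ ^ p ∧ |sch.m r.curvature k| ≤ (sch.a k)⁻¹ ^ p) ∧
      Tendsto (fun k => sch.a k * (sch.L k : ℝ) / Real.log (sch.a k)⁻¹) atTop atTop) :
    (∃ p : ℕ, ∀ᶠ k in atTop, |(subseq sch φ hφ).c r.curvature k| ≤ ((subseq sch φ hφ).a k)⁻¹ ^ p ∧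
        |(subseq sch φ hφ).m r.curvature k| ≤ ((subseq sch φ hφ).a k)⁻¹ ^ p) ∧
      Tendsto (fun k => (subseq sch φ hφ).a k * ((subseq sch φ hφ).L k : ℝ) / Real.log ((subseq sch φ hφ).a k)⁻¹) atTop atTop := by
  obtain ⟨⟨p, hp⟩, hS⟩ := h
  exact ⟨⟨p, temperateRenormalisation_subseq r sch φ hφ hp⟩, sideGrowth_subseq sch φ hφ hS⟩

end SchemeAlong

end Summit.QuantumFields.YangMills.Cruxes.DiagonalMirrorRPR.SignTwistedDiagonalTrace

end
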